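/-
Copyright (c) 2026 the pub-hodgecm-mathlib formalisation cell (harness21).  Prover seat hodgecm-mathlib-LH4-p08 (g10), req620 Track A «(D-RAM) FOUR-FRAME» squad, helper lane
on h413 = stmt-HodgeConjecture-24833 (count-neutral).  Dealer∕pen LH4-plan WORD #118 ∕ β sub-dealer LH4-p05 (g8) LEDGER #9: (β-TABLE) (T3) «THE FINITE IDENTITY
`oddLabelledBoxSum`» against the ★ (T1) v1 letter p861261 (F0P3a-p01 (g37)).  2026-09-04.
-/
import Summits.HodgeConjecture.HodgeConjecture.Theorems.F0P3cDyRamOddLabelledBoxSumDefs     -- ★ p861261 (F0P3a-p01 (g37)): (T1) v1 `IsRestShape`, `restTarget`, `OddLabelledBoxSum`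
import Summits.HodgeConjecture.HodgeConjecture.Theorems.F0P3cDyRamOddLabelledBoxSumPlanes   -- (this seat) (T3) engine part 2: `plane_total_own ∕ _plain ∕ _twisted`
import Summits.HodgeConjecture.HodgeConjecture.Theorems.F0P3cDyRamStableCountBoxReindex     -- ★ B10 (LH4-p14): `vec3_eq_iff`, `sum_box_eq_triple_sum`, `triple_sum_eq_diag_add_planes`
import HarnessLib

/-!
# Crux `H413`, line LH4 «(D-RAM) FOUR-FRAME» — (β) road, (T3): THE LABELLED-ODD BOX SUM VANISHES — `oddLabelledBoxSum : OddLabelledBoxSum` (★ (T1) v1 p861261, BY NAME)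

Cell `hodgecm-mathlib` (D-0151), FLOOR 0, crux item H413 = `stmt-HodgeConjecture-24833`, route of record `HCCMUnconditional`; squad F0∕P3c∕LH4; helper lane
`--supports stmt-HodgeConjecture-24833 --as helper` (count-neutral).  THEOREMS ONLY (no `def`, no instance, no notation, no `sorry`; default heartbeats); pure finite-sum
bookkeeping over `ℚ` (no field, no place, no lattice, no sign relation).

WHAT.  F0P3a-p01 (g37)'s (T1) v1 `F0P3cDyRamOddLabelledBoxSumDefs.OddLabelledBoxSum` (LH4-p05 (g8)'s B2b-3 architecture of the (β) table; rows ★ p860780 ∕ p860805 ∕ p860897 ∕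
p860827 ∕ p860856 of LH4-p11 (g8), the capped tube rows `hG1b ∕ hG2b ∕ hG3t`, the rest-sum row `hrest` with its target `restTarget`, zeros `hzero`) is PROVED as stated:
`theorem oddLabelledBoxSum : OddLabelledBoxSum`.  Its consumer is the (T2) trunk `…LabelledOddStageBTable.hbox_of_oddBoxSum` (F0P3a-p01 (g37)) feeding ★ p860646
`…LabelledOddStageBBoxForm.dyadicFence_cleanSgnFrameConstLawAt_derived_ofRecord_of_box`.

PROOF (the v0 engine of LH4-p08 (g9), re-cut to the v1 letter).  Split the table as `v = u + [IsRestShape]·v` with `u = [¬ IsRestShape]·v` the NON-REST table; the second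
box sum IS `hrest`'s left-hand side, so `Σ v = Σ u + restTarget i`.  The non-rest table vanishes off the shape list too, so ★ `sum_box_eq_triple_sum` + ★
`triple_sum_eq_diag_add_planes` split `Σ u` into the diagonal — ZERO (the core `hcore`, the odd diagonal `hzero`, and the even diagonal `r ≥ 2` is a rest shape) — and the
three tower planes `![r,t,t] ∕ ![t,r,t] ∕ ![t,t,r]` (`r < t`), on which `IsRestShape` reads as the plane's rest indicator.  Slot by slot (`fin_cases i` + `simp only
[Matrix.cons_val_…]` turn the (T1) vector rows into scalar rows), each plane is of type OWN ∕ PLAIN ∕ TWISTED and (this seat's engine part 2) `plane_total_own ∕ _plain ∕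
_twisted` evaluate it to `0` ∕ `[no flip class]·ω∕2·q^{nX−ℓ₀−1}` ∕ `[no flip class]·ωm·ω∕2·q^{nX−ℓ₀−1}`: slot `0` = (T1 OWN, T2 PLAIN `ωA`, T3 TWISTED `ωm·ωC`), slot `1` =
(T1 PLAIN `ωB`, T2 OWN, T3 PLAIN `ωC`), slot `2` = (T1 TWISTED `ωm·ωB`, T2 TWISTED `ωm·ωA`, T3 OWN).  By the isosceles letter the two non-own surpluses of a slot are present
exactly when that slot is the special one with `s_g ≥ 2d − 2` — and then they are the NEGATIVE of `restTarget i` (`ring`); otherwise all three vanish.  Tower 3 has no one-slot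
cell in the v1 letter (`hG3t` covers every `ρ`): its plane lemmas are called with the empty cell `C = 0`.

HONEST LABEL.  Count-neutral: a `--supports` helper that pays NO tier-0 row by itself; it proves the (T1) v1 letter AS TYPED — the open mathematics of the (β) table is the
DISCHARGE of its rows (`hG1b ∕ hG2b ∕ hG3t` PROPOSED capped-tube values, and above all `hrest`: κ-classes, glue classes, core-hanging strata) by the lattice seats, assembled by
the (T2) trunk; (β)∕table∕T₊ OPEN; `HC_CM` is proved only modulo the 7 printed citations (2 remaining named inputs: hLiu418 = `stmt-HodgeConjecture-24832`, h413 =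
`stmt-HodgeConjecture-24833`) until rung 0 closes.

## References
* [Kottwitz1986BaseChangeUnits] R. E. Kottwitz, *Base change for unit elements of Hecke algebras*, Compositio Math. 60 (1986), §1 pp. 240–241 (signed lattice counts by torus orbits).
* [Rogawski1990] J. D. Rogawski, *Automorphic Representations of Unitary Groups in Three Variables*, Ann. of Math. Stud. 123 (1990), §4.9 Prop. 4.9.1 (a)(b) p. 55, §4.10 p. 58.
* [LanglandsShelstad1987] R. P. Langlands, D. Shelstad, *On the definition of transfer factors*, Math. Ann. 278 (1987), §1.3, §3 (the κ-signs of the labelled table).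
-/

set_option autoImplicit false

namespace Summit.HodgeConjecture.HodgeConjecture.Cruxes.H413.F0P3cDyRamOddLabelledBoxSum

open Finset
open Summit.HodgeConjecture.HodgeConjecture.Cruxes.H413.F0P3cDyRamOddLabelledBoxSumDefs (IsRestShape restTarget OddLabelledBoxSum)
open Summit.HodgeConjecture.HodgeConjecture.Cruxes.H413.F0P3cDyRamOddLabelledBoxSumPlanes (plane_total_own plane_total_plain plane_total_twisted)
open Summit.HodgeConjecture.HodgeConjecture.Cruxes.H413.F0P3cDyRamStableCountBoxReindex (vec3_eq_iff sum_box_eq_triple_sum triple_sum_eq_diag_add_planes)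

/-- **(T3) THE LABELLED-ODD BOX SUM OF THE CLEAN-SHELL STAGE-B TABLE VANISHES** — F0P3a-p01 (g37)'s (T1) v1 letter `OddLabelledBoxSum` (★ p861261), proved as stated:
for every `q`, wild depth `d ≥ 2`, isosceles depths `(n₁,n₂,n₃)` in the derived regime with the parities of `d`, slot `i`, sign letters `ωA ωB ωC ωm`, and every table `v`
with the tower rows, the capped tube rows, the rest-sum row `hrest` and zeros off the shape list, `Σ_{a : Fin 3 → Fin (n₁+n₂+n₃+1)} v a = 0`.  Pure bookkeeping over `ℚ`:
non-rest∕rest split, ★ box → diagonal + planes, the plane totals of the engine, and the endgame `surpluses + restTarget = 0` by the isosceles letter.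
[cite: Kottwitz1986BaseChangeUnits, §1 pp. 240–241] [cite: Rogawski1990, §4.9 Prop. 4.9.1 (a)(b) p. 55] -/
theorem oddLabelledBoxSum : OddLabelledBoxSum := by
  intro q d n₁ n₂ n₃ hd hiso hreg h1 h2 h3 i ωA ωB ωC ωm v hcore hT1 hT2 hT3 hG1 hG2 hG1b hG2b hG3t hrest hzero
  -- (0) shape regularity and the odd rows, from `hzero`
  have hreg' : ∀ x y z : ℕ, v ![x, y, z] ≠ 0 → (x = y ∧ y = z) ∨ (y = z ∧ x < y) ∨ (x = z ∧ y < x) ∨ (x = y ∧ z < x) := by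
    intro x y z hne
    by_contra hc
    refine hne (hzero _ ?_)
    rintro (h | ⟨s', hs', hs2, h | h | h⟩ | ⟨ρ, s', hρ, hs', hs2, h | h | h⟩ | ⟨ρ, hρ, h⟩) <;> rw [vec3_eq_iff] at h <;> omega
  have hz1 : ∀ r s, 1 ≤ r → ¬ 2 ∣ r → 1 ≤ s → v ![r, r + s, r + s] = 0 := fun r s hr hr2 hs => hzero _ (by
    rintro (h | ⟨s', hs', -, h | h | h⟩ | ⟨ρ, s', hρ, hs', -, h | h | h⟩ | ⟨ρ, hρ, h⟩) <;> rw [vec3_eq_iff] at h <;> omega)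
  have hz2 : ∀ r s, 1 ≤ r → ¬ 2 ∣ r → 1 ≤ s → v ![r + s, r, r + s] = 0 := fun r s hr hr2 hs => hzero _ (by
    rintro (h | ⟨s', hs', -, h | h | h⟩ | ⟨ρ, s', hρ, hs', -, h | h | h⟩ | ⟨ρ, hρ, h⟩) <;> rw [vec3_eq_iff] at h <;> omega)
  have hz3 : ∀ r s, 1 ≤ r → ¬ 2 ∣ r → 1 ≤ s → v ![r + s, r + s, r] = 0 := fun r s hr hr2 hs => hzero _ (by
    rintro (h | ⟨s', hs', -, h | h | h⟩ | ⟨ρ, s', hρ, hs', -, h | h | h⟩ | ⟨ρ, hρ, h⟩) <;> rw [vec3_eq_iff] at h <;> omega)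
  have hz1' : ∀ r s, 2 ≤ r → 2 ∣ r → ¬ 2 ∣ s → 1 ≤ s → v ![r, r + s, r + s] = 0 := fun r s hr hr2 hs2 hs => hzero _ (by
    rintro (h | ⟨s', hs', -, h | h | h⟩ | ⟨ρ, s', hρ, hs', -, h | h | h⟩ | ⟨ρ, hρ, h⟩) <;> rw [vec3_eq_iff] at h <;> omega)
  have hz2' : ∀ r s, 2 ≤ r → 2 ∣ r → ¬ 2 ∣ s → 1 ≤ s → v ![r + s, r, r + s] = 0 := fun r s hr hr2 hs2 hs => hzero _ (by
    rintro (h | ⟨s', hs', -, h | h | h⟩ | ⟨ρ, s', hρ, hs', -, h | h | h⟩ | ⟨ρ, hρ, h⟩) <;> rw [vec3_eq_iff] at h <;> omega)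
  have hz3' : ∀ r s, 2 ≤ r → 2 ∣ r → ¬ 2 ∣ s → 1 ≤ s → v ![r + s, r + s, r] = 0 := fun r s hr hr2 hs2 hs => hzero _ (by
    rintro (h | ⟨s', hs', -, h | h | h⟩ | ⟨ρ, s', hρ, hs', -, h | h | h⟩ | ⟨ρ, hρ, h⟩) <;> rw [vec3_eq_iff] at h <;> omega)
  have hzd : ∀ r, 1 ≤ r → ¬ 2 ∣ r → v ![r, r, r] = 0 := fun r hr hr2 => hzero _ (by
    rintro (h | ⟨s', hs', -, h | h | h⟩ | ⟨ρ, s', hρ, hs', -, h | h | h⟩ | ⟨ρ, hρ, h⟩) <;> rw [vec3_eq_iff] at h <;> omega)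
  -- (1) the NON-REST table `u`, the split `v = u + [rest]·v`, and `hrest`
  obtain ⟨u, hu⟩ : ∃ u : (Fin 3 → ℕ) → ℚ, ∀ a, u a = if IsRestShape d n₁ n₂ n₃ a then 0 else v a := ⟨_, fun _ => rfl⟩
  have hsplit : ∀ a, v a = u a + (if IsRestShape d n₁ n₂ n₃ a then v a else 0) := by
    intro a; rw [hu a]; split_ifs <;> simp
  rw [Finset.sum_congr rfl fun a _ => hsplit _, Finset.sum_add_distrib, hrest]
  -- (2) box → diagonal + three planes for `u`; the diagonal vanishes
  have hregu : ∀ x y z : ℕ, u ![x, y, z] ≠ 0 → (x = y ∧ y = z) ∨ (y = z ∧ x < y) ∨ (x = z ∧ y < x) ∨ (x = y ∧ z < x) :=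
    fun x y z h => hreg' x y z fun h0 => h (by rw [hu, h0, ite_self])
  rw [sum_box_eq_triple_sum (n₁ + n₂ + n₃) u, triple_sum_eq_diag_add_planes (n₁ + n₂ + n₃) u hregu]
  -- the rest indicator on the diagonal and on the three planes (`r < t`)
  have hRd : ∀ r, IsRestShape d n₁ n₂ n₃ ![r, r, r] ↔ (2 ≤ r ∧ 2 ∣ r) := fun r => by
    constructor
    · rintro (⟨-, -, h⟩ | ⟨-, h, -⟩ | ⟨-, h, -⟩ | ⟨-, h, -⟩)
      · exact h
      all_goals exact absurd h (lt_irrefl r)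
    · exact fun h => Or.inl ⟨rfl, rfl, h⟩
  have hR1 : ∀ r t, r < t → (IsRestShape d n₁ n₂ n₃ ![r, t, t] ↔ (2 ≤ r ∧ 2 ∣ r ∧ 2 ∣ t ∧ ¬ (t + d % 2 = n₁ ∧ r + 2 + d % 2 ≤ min n₂ n₃))) :=
    fun r t hrt => by
      constructor
      · rintro (⟨h, -⟩ | ⟨-, -, h⟩ | ⟨-, h, -⟩ | ⟨-, h, -⟩)
        · exact absurd h (ne_of_lt hrt)
        · exact h
        · exact absurd h (lt_asymm hrt)
        · exact absurd h (lt_asymm hrt)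
      · exact fun h => Or.inr (Or.inl ⟨rfl, hrt, h⟩)
  have hR2 : ∀ r t, r < t → (IsRestShape d n₁ n₂ n₃ ![t, r, t] ↔ (2 ≤ r ∧ 2 ∣ r ∧ 2 ∣ t ∧ ¬ (t + d % 2 = n₂ ∧ r + 2 + d % 2 ≤ min n₁ n₃))) :=
    fun r t hrt => by
      constructor
      · rintro (⟨h, -⟩ | ⟨h, -⟩ | ⟨-, -, h⟩ | ⟨h, -⟩)
        · exact absurd h (ne_of_gt hrt)
        · exact absurd h (ne_of_lt hrt)
        · exact h
        · exact absurd h (ne_of_gt hrt)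
      · exact fun h => Or.inr (Or.inr (Or.inl ⟨rfl, hrt, h⟩))
  have hR3 : ∀ r t, r < t → (IsRestShape d n₁ n₂ n₃ ![t, t, r] ↔ (2 ≤ r ∧ 2 ∣ r ∧ 2 ∣ t ∧ ¬ (t + d % 2 = n₃ ∧ r + 2 + d % 2 ≤ min n₁ n₂))) :=
    fun r t hrt => by
      constructor
      · rintro (⟨-, h, -⟩ | ⟨h, -⟩ | ⟨h, -⟩ | ⟨-, -, h⟩)
        · exact absurd h (ne_of_gt hrt)
        · exact absurd h (ne_of_gt hrt)
        · exact absurd h (ne_of_gt hrt)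
        · exact h
      · exact fun h => Or.inr (Or.inr (Or.inr ⟨rfl, hrt, h⟩))
  have hdiag : ∑ r ∈ range (n₁ + n₂ + n₃ + 1), u ![r, r, r] = 0 := Finset.sum_eq_zero fun r _ => by
    rw [hu]
    by_cases hR : IsRestShape d n₁ n₂ n₃ ![r, r, r]
    · rw [if_pos hR]
    · rw [if_neg hR]
      rw [hRd] at hR
      rcases Nat.eq_zero_or_pos r with rfl | hr
      · exact hcore
      · exact hzd r hr (by omega)
  rw [hdiag, zero_add]
  -- (3) the three planes of `u` are the non-rest tables of the planes of `v`
  have hu1 : ∀ r t, r < t → u ![r, t, t] = if 2 ≤ r ∧ 2 ∣ r ∧ 2 ∣ t ∧ ¬ (t + d % 2 = n₁ ∧ r + 2 + d % 2 ≤ min n₂ n₃) then 0 else v ![r, t, t] :=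
    fun r t hrt => by rw [hu]; exact if_congr (hR1 r t hrt) rfl rfl
  have hu2 : ∀ r t, r < t → u ![t, r, t] = if 2 ≤ r ∧ 2 ∣ r ∧ 2 ∣ t ∧ ¬ (t + d % 2 = n₂ ∧ r + 2 + d % 2 ≤ min n₁ n₃) then 0 else v ![t, r, t] :=
    fun r t hrt => by rw [hu]; exact if_congr (hR2 r t hrt) rfl rfl
  have hu3 : ∀ r t, r < t → u ![t, t, r] = if 2 ≤ r ∧ 2 ∣ r ∧ 2 ∣ t ∧ ¬ (t + d % 2 = n₃ ∧ r + 2 + d % 2 ≤ min n₁ n₂) then 0 else v ![t, t, r] :=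
    fun r t hrt => by rw [hu]; exact if_congr (hR3 r t hrt) rfl rfl
  have hl : d % 2 ≤ 1 := Nat.lt_succ_iff.mp (Nat.mod_lt _ (by norm_num))
  -- (4) slot by slot
  fin_cases i
  · ------------------------------------------------------------------ slot 0: tower 1 OWN, tower 2 PLAIN (ωA, bracket n₁), tower 3 TWISTED (ωm·ωC, bracket n₁)
    simp only [Fin.zero_eta, Fin.isValue, Fin.reduceEq, if_true, if_false, Matrix.cons_val_zero,
      Int.cast_zero, Int.cast_mul, zero_div, zero_mul, mul_zero, ite_self] at hT1 hT2 hT3 hG1 hG2 hG1b hG2b hG3t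
    have P1 : (∑ r ∈ range (n₁ + n₂ + n₃ + 1), ∑ t ∈ range (n₁ + n₂ + n₃ + 1), if r < t then u ![r, t, t] else 0) = _ :=
      plane_total_own (fun r t => v ![r, t, t]) (fun r t => u ![r, t, t]) (C := n₂) hu1 hT1 hG1 hG1b hz1 hz1'
    have P2 : (∑ r ∈ range (n₁ + n₂ + n₃ + 1), ∑ t ∈ range (n₁ + n₂ + n₃ + 1), if r < t then u ![t, r, t] else 0) = _ :=
      plane_total_plain (fun r t => v ![t, r, t]) (fun r t => u ![t, r, t]) q ωA (C := n₁) hd hreg.2.1 hreg.1 (by omega) h2 h1 (by omega)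
        (by rcases hiso with h | h | h <;> omega) le_rfl (by omega) hu2 hT2 hG2 hG2b hz2 hz2'
    have P3 : (∑ r ∈ range (n₁ + n₂ + n₃ + 1), ∑ t ∈ range (n₁ + n₂ + n₃ + 1), if r < t then u ![t, t, r] else 0) = _ :=
      plane_total_twisted (fun r t => v ![t, t, r]) (fun r t => u ![t, t, r]) q ωC ωm (C := 0) hd hreg.2.2 hreg.1 (by omega) h3 h1 (by omega)
        (by rcases hiso with h | h | h <;> omega) (Or.inr ⟨Nat.zero_le _, Nat.zero_le _⟩) (by omega) hu3 hT3
        (fun ρ s _ _ h => absurd h (by omega)) (fun ρ s hρ _ => hG3t ρ s hρ) hz3 hz3'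
    rw [P1, P2, P3]
    simp only [restTarget, Fin.zero_eta, Fin.isValue, Matrix.cons_val_zero]
    rcases hiso with ⟨h12, h13⟩ | ⟨h13, h12⟩ | ⟨h23, h21⟩
    · rw [if_pos (by omega), if_pos (by omega), if_neg (by omega)]; ring
    · rw [if_pos (by omega), if_pos (by omega), if_neg (by omega)]; ring
    · by_cases hP : n₁ + 4 ≤ n₂ + 2 * d
      · rw [if_pos (by omega), if_pos (by omega), if_neg (by omega)]; ring
      · rw [if_neg (by omega), if_neg (by omega), if_pos (by omega), ← h23]; ring
  · ------------------------------------------------------------------ slot 1: tower 1 PLAIN (ωB, bracket n₂), tower 2 OWN, tower 3 PLAIN (ωC, bracket n₂)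
    simp only [Fin.isValue, Fin.mk_one, Fin.reduceEq, Fin.one_eq_zero_iff, if_true, if_false, Matrix.cons_val_zero, Matrix.cons_val_one,
      Nat.reduceEqDiff, Int.cast_zero, zero_div, zero_mul, mul_zero, ite_self] at hT1 hT2 hT3 hG1 hG2 hG1b hG2b hG3t
    have P1 : (∑ r ∈ range (n₁ + n₂ + n₃ + 1), ∑ t ∈ range (n₁ + n₂ + n₃ + 1), if r < t then u ![r, t, t] else 0) = _ :=
      plane_total_plain (fun r t => v ![r, t, t]) (fun r t => u ![r, t, t]) q ωB (C := n₂) hd hreg.1 hreg.2.1 (by omega) h1 h2 (by omega)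
        (by rcases hiso with h | h | h <;> omega) le_rfl (by omega) hu1 hT1 hG1 hG1b hz1 hz1'
    have P2 : (∑ r ∈ range (n₁ + n₂ + n₃ + 1), ∑ t ∈ range (n₁ + n₂ + n₃ + 1), if r < t then u ![t, r, t] else 0) = _ :=
      plane_total_own (fun r t => v ![t, r, t]) (fun r t => u ![t, r, t]) (C := n₁) hu2 hT2 hG2 hG2b hz2 hz2'
    have P3 : (∑ r ∈ range (n₁ + n₂ + n₃ + 1), ∑ t ∈ range (n₁ + n₂ + n₃ + 1), if r < t then u ![t, t, r] else 0) = _ :=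
      plane_total_plain (fun r t => v ![t, t, r]) (fun r t => u ![t, t, r]) q ωC (C := 0) hd hreg.2.2 hreg.2.1 (by omega) h3 h2 (by omega)
        (by rcases hiso with h | h | h <;> omega) (Nat.zero_le _) (by omega) hu3 hT3
        (fun ρ s _ _ h => absurd h (by omega)) (fun ρ s hρ _ => hG3t ρ s hρ) hz3 hz3'
    rw [P1, P2, P3]
    simp only [restTarget, Fin.mk_one, Fin.isValue, Matrix.cons_val_one, Matrix.cons_val_zero]
    rcases hiso with ⟨h12, h13⟩ | ⟨h13, h12⟩ | ⟨h23, h21⟩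
    · rw [if_pos (by omega), if_pos (by omega), if_neg (by omega)]; ring
    · by_cases hP : n₂ + 4 ≤ n₁ + 2 * d
      · rw [if_pos (by omega), if_pos (by omega), if_neg (by omega)]; ring
      · rw [if_neg (by omega), if_neg (by omega), if_pos (by omega), ← h13]; ring
    · rw [if_pos (by omega), if_pos (by omega), if_neg (by omega)]; ring
  · ------------------------------------------------------------------ slot 2: tower 1 TWISTED (ωm·ωB, bracket n₃), tower 2 TWISTED (ωm·ωA, bracket n₃), tower 3 OWN
    simp only [Fin.isValue, Fin.reduceFinMk, Fin.reduceEq, if_true, if_false, Matrix.head_cons, Matrix.cons_val_two, Matrix.tail_cons,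
      Int.cast_zero, Int.cast_mul, zero_div, zero_mul, mul_zero, ite_self] at hT1 hT2 hT3 hG1 hG2 hG1b hG2b hG3t
    have P1 : (∑ r ∈ range (n₁ + n₂ + n₃ + 1), ∑ t ∈ range (n₁ + n₂ + n₃ + 1), if r < t then u ![r, t, t] else 0) = _ :=
      plane_total_twisted (fun r t => v ![r, t, t]) (fun r t => u ![r, t, t]) q ωB ωm (C := n₂) hd hreg.1 hreg.2.2 (by omega) h1 h3 (by omega)
        (by rcases hiso with h | h | h <;> omega) (by rcases hiso with h | h | h <;> omega) (by omega) hu1 hT1 hG1 hG1b hz1 hz1'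
    have P2 : (∑ r ∈ range (n₁ + n₂ + n₃ + 1), ∑ t ∈ range (n₁ + n₂ + n₃ + 1), if r < t then u ![t, r, t] else 0) = _ :=
      plane_total_twisted (fun r t => v ![t, r, t]) (fun r t => u ![t, r, t]) q ωA ωm (C := n₁) hd hreg.2.1 hreg.2.2 (by omega) h2 h3 (by omega)
        (by rcases hiso with h | h | h <;> omega) (by rcases hiso with h | h | h <;> omega) (by omega) hu2 hT2 hG2 hG2b hz2 hz2'
    have P3 : (∑ r ∈ range (n₁ + n₂ + n₃ + 1), ∑ t ∈ range (n₁ + n₂ + n₃ + 1), if r < t then u ![t, t, r] else 0) = _ :=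
      plane_total_own (fun r t => v ![t, t, r]) (fun r t => u ![t, t, r]) (C := 0) hu3 hT3
        (fun ρ s _ _ h => absurd h (by omega)) (fun ρ s hρ _ => hG3t ρ s hρ) hz3 hz3'
    rw [P1, P2, P3]
    simp only [restTarget, Fin.reduceFinMk, Matrix.cons_val_two, Matrix.tail_cons, Matrix.head_cons]
    rcases hiso with ⟨h12, h13⟩ | ⟨h13, h12⟩ | ⟨h23, h21⟩
    · by_cases hP : n₃ + 4 ≤ n₁ + 2 * d
      · rw [if_pos (by omega), if_pos (by omega), if_neg (by omega)]; ring
      · rw [if_neg (by omega), if_neg (by omega), if_pos (by omega), ← h12]; ring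
    · rw [if_pos (by omega), if_pos (by omega), if_neg (by omega)]; ring
    · rw [if_pos (by omega), if_pos (by omega), if_neg (by omega)]; ring

end Summit.HodgeConjecture.HodgeConjecture.Cruxes.H413.F0P3cDyRamOddLabelledBoxSum
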